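/-
Copyright (c) 2026. All rights reserved.
Released under Apache 2.0 license as described in the file LICENSE.
-/
import Literature.NumberTheory.Automorphic.BrandtModuleLevelOneTwo
import HarnessLib

/-!
# The definite congruence number at level `(1, 2)`: `ξ(λ; 1, 2) = 12` if `λ(p) = p + 1` for every odd prime `p`
# (the Eisenstein eigenvalues), and `0` otherwise

[tag: quaternion_algebra] [tag: brandt_matrix] [tag: hecke_operator] [tag: congruence_number]

Topic `NumberTheory/Automorphic`; THEOREMS ONLY (no definition, no named fact, no instance; net Literature debt `0`).
Lane `lit-hodgefound`, seat p12, row g44-#9. Sequel to `BrandtModuleLevelOneTwo` (row g44-#8: for every Brandt setup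
`S : Brandt.XiSetup 1 2`, `# Cls S.O = 1`, `w = 12`, `T(p) = p + 1` for odd primes `p`). The tree's headline object of
`BrandtXi.lean` is the definite congruence number of Pollack–Weston 2011 §2.1,
`brandtXi N⁺ N⁻ λ = ξ(λ; N⁺, N⁻) = ⟨φ, φ⟩ = Σ_i w_i φ_i²` where `ℤφ = L(λ) = {v ∈ ℤ[Cls O] : T(p)v = λ(p)v ∀ p ∤ N⁺N⁻}`
if that common eigen-lattice is a line, and `0` otherwise. At the first level `(N⁺, N⁻) = (1, 2)` everything is explicit:
`ℤ[Cls O] = ℤ` and `T(p) = p + 1`, so `L(λ) = ℤ` when `λ(p) = p + 1` for all odd primes `p` — the eigenvalues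
`a_p = σ(p) = p + 1` of the EISENSTEIN vector `e₀` (Gross 1987 §1; there is no cusp form of weight `2` and level `2`) —
and `L(λ) = 0` otherwise; hence `ξ = w · 1² = 12` or `ξ = 0`:

* §1 (every `S : XiSetup 1 2`, any `Fintype` structure on `Cls S.O`) `xiSetup_matrix_mulVec_prime` (`T(p)v = (p + 1)v`),
  **`xiSetup_mem_eigenLattice_iff`** (`v ∈ L(λ) ⟺ v = 0 ∨ ∀ odd primes p, λ(p) = p + 1`), `xiSetup_eigenLattice_eq_top`,
  `xiSetup_eigenLattice_eq_bot`, **`xiSetup_xi_eigenLattice_eq_twelve`** ∕ **`_eq_zero`** (`xi w L(λ) = 12`, resp. `0`),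
  `xiSetup_xi_eq_twelve` ∕ `xiSetup_xi_eq_zero` (`S.xi λ`);
* §2 **`brandtXi_one_two_eq_twelve`** (`λ(p) = p + 1` for all odd primes `p` ⟹ `brandtXi 1 2 λ = 12`),
  **`brandtXi_one_two_eq_zero`** (otherwise `brandtXi 1 2 λ = 0`), `brandtXi_one_two_le` (`≤ 12` always),
  `brandtXi_one_two_succ` (`λ(n) = n + 1`: `ξ = 12`), `brandtXi_one_two_sum_odd_divisors` (`λ(n) = σ_odd(n)`, the eigenvalues of
  `T(n)` itself: `ξ = 12`), `brandtXi_one_two_zero` (`λ = 0`: `ξ = 0`);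
* §3 (every `P : EichlerPackage 1 2`, in the transposed convention of `BrandtModule.lean`, via `EichlerPackage.xi_toXiSetup`)
  `eichlerPackage_xi_eq_twelve` ∕ `eichlerPackage_xi_eq_zero`.

## Sources

* D. Pollack, T. Weston, *On anticyclotomic μ-invariants of modular forms*, Compos. Math. 147 (2011), §2.1 (the Brandt module
  `M = ℤ[Cls O]` of level `(N⁺, N⁻)`, the eigen-module `M^f`, `ξ_f(N⁺, N⁻) = ⟨g_f, g_f⟩`). [cite: PollackWeston2011, §2.1]
* B. H. Gross, *Heights and the special values of L-series*, CMS Conf. Proc. 7 (1987), §1 and §§3–4 (`e₀ = Σ e_i / w_i`, the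
  Eisenstein vector with `t_m e₀ = σ(m)… `; `⟨e_i, e_j⟩ = w_i δ_ij`). [cite: Gross1987, §1 and §§3–4]
* J. Voight, *Quaternion Algebras*, GTM 288 (2021), Example 41.5.12 (`(−1, −1 | ℚ)`, the Hurwitz order: `# Cls O = 1`,
  `T(n) = σ(n)` for `n` odd) and Remark 41.5.13. [cite: Voight2021, Example 41.5.12 and Remark 41.5.13]

## Scope (honest)

Theorems only — no definition, no named fact, no instance. Level `(1, 2)` only. The dichotomy is stated as two implications
(no `if … then … else` over an undecidable hypothesis); nothing is claimed about modular forms.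
-/

open Quaternion
open Finset
open scoped Matrix
open Literature.NumberTheory.Waring
open Literature.NumberTheory.Automorphic.Brandt

namespace Literature.NumberTheory.Automorphic.HurwitzOrder

/-! ## §1 The eigen-lattice and `ξ` of a setup of type `(1, 2)` -/

section Setup

variable (S : XiSetup 1 2) [Fintype (ClassSet S.O)] (lam : ℕ → ℤ)

/-- `T(p) v = (p + 1) v` on `ℤ[Cls S.O] = ℤ` for an odd prime `p`. [cite: Voight2021, Example 41.5.12] -/
theorem xiSetup_matrix_mulVec_prime {p : ℕ} (hp : p.Prime) (hp2 : p ≠ 2) (v : ClassSet S.O → ℤ) :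
    Brandt.matrix S.O p *ᵥ v = ((p : ℤ) + 1) • v := by
  haveI := xiSetup_subsingleton_classSet S
  funext c
  simp only [Matrix.mulVec, dotProduct, Pi.smul_apply, smul_eq_mul]
  rw [Fintype.sum_subsingleton _ c, xiSetup_matrix_prime S hp hp2]

/-- **The common eigen-lattice at level `(1, 2)`**: `v ∈ L(λ) ⟺ v = 0 ∨ λ(p) = p + 1` for every odd prime `p`.
[cite: PollackWeston2011, §2.1] [cite: Voight2021, Example 41.5.12] -/
theorem xiSetup_mem_eigenLattice_iff (v : ClassSet S.O → ℤ) :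
    v ∈ eigenLattice 2 (Brandt.matrix S.O) lam ↔ v = 0 ∨ ∀ p : ℕ, p.Prime → p ≠ 2 → lam p = p + 1 := by
  haveI := xiSetup_subsingleton_classSet S
  obtain ⟨c₀⟩ := xiSetup_nonempty_classSet S
  rw [mem_eigenLattice_iff]
  constructor
  · intro h
    by_cases hv : v = 0
    · exact Or.inl hv
    · refine Or.inr fun p hp hp2 => ?_
      have hv0 : v c₀ ≠ 0 := fun h0 => hv (funext fun c => by rw [Subsingleton.elim c c₀, h0, Pi.zero_apply])
      have hp2' : ¬ p ∣ 2 := fun hd => hp2 ((Nat.prime_dvd_prime_iff_eq hp Nat.prime_two).mp hd)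
      have key := congrFun (h p hp hp2') c₀
      rw [xiSetup_matrix_mulVec_prime S hp hp2, Pi.smul_apply, Pi.smul_apply, smul_eq_mul, smul_eq_mul] at key
      exact (mul_right_cancel₀ hv0 key).symm
  · rintro (rfl | h) p hp hp2
    · rw [Matrix.mulVec_zero, smul_zero]
    · have hp2' : p ≠ 2 := fun h2 => hp2 (h2 ▸ dvd_rfl)
      rw [xiSetup_matrix_mulVec_prime S hp hp2', h p hp hp2']

/-- Eisenstein eigenvalues: `L(λ) = ℤ[Cls S.O]`. [cite: PollackWeston2011, §2.1] [cite: Gross1987, §1 and §§3–4] -/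
theorem xiSetup_eigenLattice_eq_top (h : ∀ p : ℕ, p.Prime → p ≠ 2 → lam p = p + 1) :
    eigenLattice 2 (Brandt.matrix S.O) lam = ⊤ :=
  eq_top_iff.mpr fun v _ => (xiSetup_mem_eigenLattice_iff S lam v).mpr (Or.inr h)

/-- Any other eigenvalues: `L(λ) = 0`. [cite: PollackWeston2011, §2.1] -/
theorem xiSetup_eigenLattice_eq_bot (h : ¬ ∀ p : ℕ, p.Prime → p ≠ 2 → lam p = p + 1) :
    eigenLattice 2 (Brandt.matrix S.O) lam = ⊥ :=
  eq_bot_iff.mpr fun v hv => by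
    rcases (xiSetup_mem_eigenLattice_iff S lam v).mp hv with rfl | h'
    · exact Submodule.zero_mem _
    · exact absurd h' h

omit [Fintype (ClassSet S.O)] in
/-- `ℤ[Cls S.O] = ℤ · 𝟙` (one class). [folklore] -/
private theorem top_eq_span_one : (⊤ : Submodule ℤ (ClassSet S.O → ℤ)) = ℤ ∙ (fun _ => (1 : ℤ)) := by
  haveI := xiSetup_subsingleton_classSet S
  obtain ⟨c₀⟩ := xiSetup_nonempty_classSet S
  refine (eq_top_iff.mpr fun v _ => Submodule.mem_span_singleton.mpr ⟨v c₀, funext fun c => ?_⟩).symm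
  rw [Pi.smul_apply, smul_eq_mul, mul_one, Subsingleton.elim c c₀]

/-- **`ξ = ⟨𝟙, 𝟙⟩ = w = 12` for the Eisenstein eigenvalues** (`λ(p) = p + 1` for all odd primes `p`). [cite: PollackWeston2011, §2.1] [cite: Gross1987, §1 and §§3–4] -/
theorem xiSetup_xi_eigenLattice_eq_twelve (h : ∀ p : ℕ, p.Prime → p ≠ 2 → lam p = p + 1) :
    xi (weight S.O) (eigenLattice 2 (Brandt.matrix S.O) lam) = 12 := by
  haveI := xiSetup_subsingleton_classSet S
  obtain ⟨c₀⟩ := xiSetup_nonempty_classSet S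
  have h1 : (fun _ : ClassSet S.O => (1 : ℤ)) ≠ 0 := fun h0 => one_ne_zero (congrFun h0 c₀)
  rw [xiSetup_eigenLattice_eq_top S lam h, xi_eq_sum (weight S.O) h1 (top_eq_span_one S),
    Fintype.sum_subsingleton _ c₀, xiSetup_weight]
  rfl

/-- **`ξ = 0` for any other eigenvalues** (`L(λ) = 0` is not a line). [cite: PollackWeston2011, §2.1] -/
theorem xiSetup_xi_eigenLattice_eq_zero (h : ¬ ∀ p : ℕ, p.Prime → p ≠ 2 → lam p = p + 1) :
    xi (weight S.O) (eigenLattice 2 (Brandt.matrix S.O) lam) = 0 := by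
  rw [xiSetup_eigenLattice_eq_bot S lam h, xi_of_not_isLine]
  rintro ⟨φ, hφ, hbot⟩
  have hmem : φ ∈ (⊥ : Submodule ℤ (ClassSet S.O → ℤ)) := by
    rw [hbot]
    exact Submodule.mem_span_singleton_self φ
  exact hφ ((Submodule.mem_bot ℤ).mp hmem)

omit [Fintype (ClassSet S.O)] in
/-- `S.xi λ = 12` for the Eisenstein eigenvalues. [cite: PollackWeston2011, §2.1] [cite: Gross1987, §1 and §§3–4] -/
theorem xiSetup_xi_eq_twelve (h : ∀ p : ℕ, p.Prime → p ≠ 2 → lam p = p + 1) : S.xi lam = 12 := by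
  haveI : Fintype (ClassSet S.O) := Fintype.ofFinite _
  show xiOfOrder S.O (1 * 2) lam = 12
  rw [one_mul, xiOfOrder_eq]
  exact xiSetup_xi_eigenLattice_eq_twelve S lam h

omit [Fintype (ClassSet S.O)] in
/-- `S.xi λ = 0` for any other eigenvalues. [cite: PollackWeston2011, §2.1] -/
theorem xiSetup_xi_eq_zero (h : ¬ ∀ p : ℕ, p.Prime → p ≠ 2 → lam p = p + 1) : S.xi lam = 0 := by
  haveI : Fintype (ClassSet S.O) := Fintype.ofFinite _
  show xiOfOrder S.O (1 * 2) lam = 0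
  rw [one_mul, xiOfOrder_eq]
  exact xiSetup_xi_eigenLattice_eq_zero S lam h

end Setup

/-! ## §2 `brandtXi 1 2` -/

section BrandtXi

/-- A Brandt setup of type `(1, 2)` exists: `(ℍ[ℚ], O)`. [cite: Voight2021, Example 41.5.12] -/
theorem nonempty_xiSetup_one_two : Nonempty (XiSetup 1 2) :=
  haveI := isQuaternionAlgebra_rat
  ⟨{ D := ℍ[ℚ]
     isQuaternionAlgebra := isQuaternionAlgebra_rat
     isTotallyDefinite := isTotallyDefinite
     squarefree := Nat.prime_two.prime.squarefree
     ramifiedPlaces_eq := ramifiedPlaces_eq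
     O := (AddSubgroup.toIntSubmodule HurwitzQuaternions.hurwitz.toAddSubgroup)
     isEichlerOrder := brandt_isEichlerOrder_one_lattice }⟩

/-- **`ξ(λ; 1, 2) = 12` WHEN `λ(p) = p + 1` FOR EVERY ODD PRIME `p`** (the Eisenstein eigenvalues; `ξ = ⟨𝟙, 𝟙⟩ = w = 12`).
[cite: PollackWeston2011, §2.1] [cite: Gross1987, §1 and §§3–4] [cite: Voight2021, Example 41.5.12] -/
theorem brandtXi_one_two_eq_twelve (lam : ℕ → ℤ) (h : ∀ p : ℕ, p.Prime → p ≠ 2 → lam p = p + 1) :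
    brandtXi 1 2 lam = 12 := by
  obtain ⟨S, hS⟩ := exists_brandtXi_eq nonempty_xiSetup_one_two lam
  rw [hS, xiSetup_xi_eq_twelve S lam h]

/-- **`ξ(λ; 1, 2) = 0` OTHERWISE** (some odd prime `p` with `λ(p) ≠ p + 1`: the eigen-lattice is `0`). [cite: PollackWeston2011, §2.1] -/
theorem brandtXi_one_two_eq_zero (lam : ℕ → ℤ) (h : ¬ ∀ p : ℕ, p.Prime → p ≠ 2 → lam p = p + 1) :
    brandtXi 1 2 lam = 0 := by
  obtain ⟨S, hS⟩ := exists_brandtXi_eq nonempty_xiSetup_one_two lam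
  rw [hS, xiSetup_xi_eq_zero S lam h]

/-- `ξ(λ; 1, 2) ≤ 12` for every `λ`. [cite: PollackWeston2011, §2.1] -/
theorem brandtXi_one_two_le (lam : ℕ → ℤ) : brandtXi 1 2 lam ≤ 12 := by
  by_cases h : ∀ p : ℕ, p.Prime → p ≠ 2 → lam p = p + 1
  · rw [brandtXi_one_two_eq_twelve lam h]
  · rw [brandtXi_one_two_eq_zero lam h]
    exact Nat.zero_le _

/-- `ξ(λ; 1, 2) ∈ {0, 12}`. [cite: PollackWeston2011, §2.1] -/
theorem brandtXi_one_two_eq_zero_or (lam : ℕ → ℤ) : brandtXi 1 2 lam = 0 ∨ brandtXi 1 2 lam = 12 := by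
  by_cases h : ∀ p : ℕ, p.Prime → p ≠ 2 → lam p = p + 1
  · exact Or.inr (brandtXi_one_two_eq_twelve lam h)
  · exact Or.inl (brandtXi_one_two_eq_zero lam h)

/-- `λ(n) = n + 1`: `ξ = 12`. [cite: Gross1987, §1 and §§3–4] -/
theorem brandtXi_one_two_succ : brandtXi 1 2 (fun n => (n : ℤ) + 1) = 12 :=
  brandtXi_one_two_eq_twelve _ fun _ _ _ => rfl

/-- `λ(n) = σ_odd(n) = Σ_{d ∣ n, d odd} d`, the eigenvalues of the Brandt matrices `T(n)` themselves: `ξ = 12`. [cite: Voight2021, Example 41.5.12] [cite: Gross1987, §1 and §§3–4] -/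
theorem brandtXi_one_two_sum_odd_divisors :
    brandtXi 1 2 (fun n => ((∑ d ∈ n.divisors with Odd d, d : ℕ) : ℤ)) = 12 := by
  refine brandtXi_one_two_eq_twelve _ fun p hp hp2 => ?_
  show ((∑ d ∈ p.divisors with Odd d, d : ℕ) : ℤ) = p + 1
  rw [sum_odd_divisors_of_odd (hp.odd_of_ne_two hp2), Nat.Prime.divisors hp, sum_pair hp.one_lt.ne]
  push_cast
  ring

/-- `λ(n) = σ(n)`: `ξ = 12` (only odd primes are tested). [cite: Voight2021, Example 41.5.12] -/
theorem brandtXi_one_two_sigma : brandtXi 1 2 (fun n => ((ArithmeticFunction.sigma 1 n : ℕ) : ℤ)) = 12 := by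
  refine brandtXi_one_two_eq_twelve _ fun p hp _ => ?_
  show ((ArithmeticFunction.sigma 1 p : ℕ) : ℤ) = p + 1
  rw [ArithmeticFunction.sigma_one_apply, Nat.Prime.divisors hp, sum_pair hp.one_lt.ne]
  push_cast
  ring

/-- `λ = 0`: `ξ = 0`. [cite: PollackWeston2011, §2.1] -/
theorem brandtXi_one_two_zero : brandtXi 1 2 0 = 0 :=
  brandtXi_one_two_eq_zero _ fun h => by
    have h3 := h 3 Nat.prime_three (by norm_num)
    norm_num at h3

end BrandtXi

/-! ## §3 Eichler packages of level `(1, 2)` (transposed convention of `BrandtModule.lean`) -/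

section Package

/-- `ξ = 12` computed on the Brandt data of any Eichler package of level `(1, 2)`, Eisenstein eigenvalues. [cite: PollackWeston2011, §2.1] [cite: Gross1987, §1 and §§3–4] -/
theorem eichlerPackage_xi_eq_twelve (P : EichlerPackage 1 2) (lam : ℕ → ℤ)
    (h : ∀ p : ℕ, p.Prime → p ≠ 2 → lam p = p + 1) :
    xi P.brandtData.w (eigenLattice (1 * 2) (fun n => (P.brandtData.T n).transpose) lam) = 12 := by
  rw [← EichlerPackage.xi_toXiSetup P Nat.prime_two.prime.squarefree lam]
  exact xiSetup_xi_eq_twelve _ lam h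

/-- `ξ = 0` computed on the Brandt data of any Eichler package of level `(1, 2)`, other eigenvalues. [cite: PollackWeston2011, §2.1] -/
theorem eichlerPackage_xi_eq_zero (P : EichlerPackage 1 2) (lam : ℕ → ℤ)
    (h : ¬ ∀ p : ℕ, p.Prime → p ≠ 2 → lam p = p + 1) :
    xi P.brandtData.w (eigenLattice (1 * 2) (fun n => (P.brandtData.T n).transpose) lam) = 0 := by
  rw [← EichlerPackage.xi_toXiSetup P Nat.prime_two.prime.squarefree lam]
  exact xiSetup_xi_eq_zero _ lam h

end Package

end Literature.NumberTheory.Automorphic.HurwitzOrder
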